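import Literature.NumberTheory.Automorphic.QuadraticHermitianNormSplitForm
import Literature.NumberTheory.Weil1965.ThetaIntegralOrbitFunctionalUnitary
import Literature.NumberTheory.Automorphic.AdelicVectorPlaceSplitting
import Literature.NumberTheory.Weil1964.LocalLinearChangeOfVariables
import HarnessLib

/-!
# The hermitian norm `hNorm` of the doubled theta carrier: closed formula, `v`-components, and the SPLIT-PLACE model
# `(x, y) ↦ x ⬝ᵥ y` at a finite place `v` of `F` split in `E`

Topic `NumberTheory/Weil1965`; namespaces `Literature.NumberTheory.Weil1965.SplitPlace` (§1, generic) and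
`Literature.NumberTheory.Weil1965.UnitaryDoubling` (§2–§3, the E-2 carriers of ★ `ThetaIntegralOrbitFunctionalUnitary`).
KERNEL mathematics only: theorems (no `def`, no named fact, no instance, no `sorry`).

THE MATHEMATICS ([Weil1965] Chap. V n° 50 pp. 72–74: the proof of Thm 4 runs at ONE finite place `v` where the algebra
is of type (II), i.e. [Weil1965] Chap. II n° 21–23 pp. 32–36: `i_X(x, y) = ᵗy′·x`, `U ≅ GL(m)` acting by `(u, ᵗu′⁻¹)`;
Chap. VI n° 52 pp. 77–78: such places exist).  For the doubled dual pair `(U(J_V), U(W ⊕ W⁻))` of the cell's E-2 line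
the carrier is `X□(𝔸) = 𝔸_F^{n+n}` and Weil's invariant is ★ `hNorm`:
* §1 (generic, any non-archimedean local field `K`): a `K`-linear equivalence `(Fin (n+n) → K) ≃ (Fin n → K) × (Fin n → K)`
  maps the product Haar measure to a POSITIVE multiple of the product Haar measure (`exists_map_linearEquiv_pi_eq_smul_prod`;
  ★ `Weil1964/LocalLinearChangeOfVariables` + Mathlib's structural measure-preserving equivalences);
* §2 THE CLOSED FORMULA **`hNorm x = x¹ ⬝ᵥ 𝕋 x¹ - d̂ · (x² ⬝ᵥ 𝕋⁻¹ x²)`** (`x¹ = x ∘ Fin.castAdd n`, `x² = x ∘ Fin.natAdd n`,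
  `𝕋 = adelicGram`; `hNorm_eq_sub_dotProduct`, from ★ `QuadraticHermitianNormSplitForm.re_hermForm_darboux`), hence its
  `v`-COMPONENT `(hNorm x)_v = Q_v(x_v)` with `Q_v y = y¹ ⬝ᵥ 𝕋_v y¹ - d · (y² ⬝ᵥ 𝕋_v⁻¹ y²)`, `𝕋_v = gram ⊗ 1 ∈ M_n(F_v)`,
  `x_v = AdelicVector.evalAt x` (`evalAt_hNorm`; ★ `AdelicVectorPlaceSplitting`);
* §3 AT A PLACE `v` WITH `s ∈ F_v`, `s² = d` (i.e. `v` split in `E = F(δ)`): the split coordinates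
  **`β_v y = (y¹ + s 𝕋_v⁻¹ y², 𝕋_v y¹ - s y²)`** are a linear equivalence `(Fin (n+n) → F_v) ≃ (Fin n → F_v) × (Fin n → F_v)`
  with `Q_v y = (β_v y).1 ⬝ᵥ (β_v y).2` (so `a_v = 1`), explicit inverse, and Haar ↦ `c • Haar × Haar`, `c > 0`
  (`exists_splitBeta_adicCompletion`) — the (BRIDGE-v) input identifying the fibres `hNorm = b` at `v` with the fibres
  `x ⬝ᵥ y = b` of ★ `Weil1965/SplitPlaceFibreMeasure*`;
* §4 THE GROUP SIDE at `v`: the `v`-component of the adelic hermitian matrix of `V ⊗ W` is `(T_V ⊗ 1 ⊗ₖ T_W ⊗ 1) ⊗ 1`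
  (`adelicPairForm_map_adeleToLocal`), the geometric action of a local unitary `g = g₁ + g₂δ` becomes the dual pair
  `(g_w ·, (g_w⁻¹)ᵀ ·)`, `g_w = reindex e e (g₁ + s g₂)`, in the split coordinates (`exists_gl_split_intertwine_adicCompletion`)
  and `g ↦ g_w` is ONTO `GL_n(F_v)` (`exists_mem_unitaryGroupOfForm_adicCompletion_of_gl`) — ★ `QuadraticHermitianNormSplitForm`
  at the local quadratic datum ★ `isQuadraticCoordinates_local`, renumbered by `finSumFinEquiv`;
* §5 the `«local»` (`U(J_V)(F_v)`) currency of the group side: `u ⊗ 1` is unitary for the pair form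
  (`kroneckerGL_one_mem_pairForm`) and `u ↦ (u ⊗ 1)_w` is onto `GL_n(F_v)` (`exists_mem_local_of_gl`,
  `u ∈ UnitaryGroup.«local» E c N J_V v` — the group ★ `UnitaryGroupPlaceInclusion` lifts to `U(J_V)(𝔸)`); the local
  coordinates of `toHermVec`∕`vDiagAct` themselves are ★ `ThetaIntegralGeometricActionAtPlace` (`adeleToLocal_toHermVec`,
  `evalAt_vDiagAct_comp`).

USE: cell `hodgecm-mathlib`, FLOOR-0 P4, ENGINE E-2, crux H413 child `Cruxes/H413/Lines/F0_E2SiegelWeilWeilRange.lean`,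
stub `stub_SW2_siegelWeil`, I-CLOSE sheet (BRIDGE-v) «β_v-half» (consumers: I-CLOSE core, (E-FAC), the split-place frame
`e = (β_v × id) ∘ placeSplitting⁻¹`).  HC_CM is proved only modulo the printed citations until rung 0 closes.

## References
* [Weil1965] A. Weil, *Sur la formule de Siegel dans la théorie des groupes classiques*, Acta Math. 113 (1965) 1–87:
  Chap. II n° 21–23 pp. 32–36 (type (II)), Chap. IV n° 41 (35) p. 59 (`i_X`, the fibres `U(i)`), Chap. V n° 50
  pp. 72–74 (Thm 4, one split place), Chap. VI n° 52 pp. 77–78.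
* [WeilBNT1967] A. Weil, *Basic Number Theory* (1967), Chap. I §2 Th. 3 Cor. 3 pp. 6–7 (module of an automorphism).
* [GelbartRogawski1991] S. Gelbart, J. Rogawski, Invent. Math. 105 (1991), §3.1 p. 454.
-/

set_option autoImplicit false

noncomputable section

open scoped Matrix Kronecker NNReal ENNReal
open _root_.MeasureTheory NumberField IsDedekindDomain Matrix

/-! ## §1 A linear equivalence `K^{n+n} ≃ K^n × K^n` maps Haar measure to a positive multiple of Haar × Haar -/

namespace Literature.NumberTheory.Weil1965.SplitPlace

open Literature.NumberTheory.GaloisRepresentations.IsNonarchimedeanLocalField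
open Literature.NumberTheory.Weil1964 Literature.NumberTheory.Automorphic

variable {K : Type*} [Field K] [ValuativeRel K] [TopologicalSpace K] [IsNonarchimedeanLocalField K]
variable [MeasurableSpace K] [BorelSpace K] (μ : Measure K) [μ.IsAddHaarMeasure]

/-- **a linear equivalence `β : K^{n+n} ≃ K^n × K^n` maps the product Haar measure to `c • (Haar × Haar)` with `c > 0`**
(`c = ‖det A‖⁻¹` for the automorphism `A = P⁻¹ ∘ β` of `K^{n+n}`, `P` the coordinate splitting, which is measure preserving):
Weil's «module of an automorphism». [cite: WeilBNT1967, Chap. I §2, Th. 3 Cor. 3, pp. 6–7] -/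
theorem exists_map_linearEquiv_pi_eq_smul_prod {n : ℕ}
    (β : (Fin (n + n) → K) ≃ₗ[K] ((Fin n → K) × (Fin n → K))) :
    ∃ c : ℝ≥0, 0 < c ∧
      Measure.map β (Measure.pi fun _ : Fin (n + n) => μ) =
        (c : ℝ≥0∞) • ((Measure.pi fun _ : Fin n => μ).prod (Measure.pi fun _ : Fin n => μ)) := by
  classical
  haveI : T2Space K := (isLocalField K).toT2Space
  haveI : LocallyCompactSpace K := (isLocalField K).toLocallyCompactSpace
  haveI : SecondCountableTopology K := secondCountableTopology_localField K
  haveI : SigmaFinite μ := by infer_instance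
  -- the coordinate splitting `P x = (x ∘ castAdd, x ∘ natAdd)` as a linear and as a measurable equivalence
  let P : (Fin (n + n) → K) ≃ₗ[K] ((Fin n → K) × (Fin n → K)) :=
    (LinearEquiv.funCongrLeft K K finSumFinEquiv).trans (LinearEquiv.sumArrowLequivProdArrow (Fin n) (Fin n) K K)
  let Pm : (Fin (n + n) → K) ≃ᵐ ((Fin n → K) × (Fin n → K)) :=
    (MeasurableEquiv.piCongrLeft (fun _ : Fin (n + n) => K) finSumFinEquiv).symm.trans
      (MeasurableEquiv.sumPiEquivProdPi fun _ : Fin n ⊕ Fin n => K)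
  have hPPm : (P : (Fin (n + n) → K) → (Fin n → K) × (Fin n → K)) = Pm := by
    funext x
    rfl
  have hPm : MeasurePreserving Pm (Measure.pi fun _ : Fin (n + n) => μ)
      ((Measure.pi fun _ : Fin n => μ).prod (Measure.pi fun _ : Fin n => μ)) :=
    ((measurePreserving_piCongrLeft (fun _ : Fin (n + n) => μ) finSumFinEquiv).symm _).trans
      (measurePreserving_sumPiEquivProdPi fun _ : Fin n ⊕ Fin n => μ)
  -- the automorphism `A = P⁻¹ ∘ β`
  let A : (Fin (n + n) → K) ≃ₗ[K] (Fin (n + n) → K) := β.trans P.symm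
  have hβ : (β : (Fin (n + n) → K) → (Fin n → K) × (Fin n → K)) = Pm ∘ (A : (Fin (n + n) → K) →ₗ[K] (Fin (n + n) → K)) := by
    funext x
    change β x = P (P.symm (β x))
    rw [LinearEquiv.apply_symm_apply]
  have hdet : LinearMap.det (A : (Fin (n + n) → K) →ₗ[K] (Fin (n + n) → K)) ≠ 0 := by
    simpa using (LinearEquiv.isUnit_det' A).ne_zero
  refine ⟨normAbs K (LinearMap.det (A : (Fin (n + n) → K) →ₗ[K] (Fin (n + n) → K)))⁻¹, ?_, ?_⟩
  · exact pos_iff_ne_zero.2 fun h0 => inv_ne_zero hdet ((map_eq_zero _).1 h0)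
  · rw [hβ, ← Measure.map_map Pm.measurable (measurable_linearMap_pi _), map_linearMap_pi_eq_smul μ hdet,
      Measure.map_smul, hPm.map_eq]

end Literature.NumberTheory.Weil1965.SplitPlace

/-! ## §2 The closed formula for `hNorm` and its `v`-components -/

namespace Literature.NumberTheory.Weil1965.UnitaryDoubling

open Literature.NumberTheory.Automorphic Literature.NumberTheory.Automorphic.UnitaryGroup
open Literature.NumberTheory.Automorphic.UnitaryGroup.QuadraticCoordinates
open Literature.NumberTheory.GelbartRogawski1991
open Literature.RepresentationTheory.HeisenbergGroup

variable (F E : Type) [Field F] [NumberField F] [Field E] [NumberField E] [Algebra F E] [Algebra.IsQuadraticExtension F E]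
  (c : E ≃ₐ[F] E) {δ : E} (hcδ : c δ = -δ) (hδ : δ ≠ 0) {d : F} (hd : δ * δ = algebraMap F E d)
  (N : ℕ) {n : ℕ} (e : Fin N × Fin 1 ≃ Fin n)
  (TV : Matrix (Fin N) (Fin N) F) (hV : TV.IsSymm) (hVd : IsUnit TV.det)
  (TW : Matrix (Fin 1) (Fin 1) F) (hW : TW.IsSymm) (hWd : IsUnit TW.det)

/-- Kronecker products commute with entrywise ring maps. [folklore] -/
private theorem kronecker_map' {R S : Type*} [CommRing R] [CommRing S] (f : R →+* S) {m m' : Type*}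
    (A : Matrix m m R) (B : Matrix m' m' R) : (A ⊗ₖ B).map f = A.map f ⊗ₖ B.map f := by
  ext ⟨i, i'⟩ ⟨j, j'⟩
  simp only [Matrix.map_apply, Matrix.kroneckerMap_apply, map_mul]

omit [Algebra.IsQuadraticExtension F E] in
/-- the hermitian matrix of `V ⊗ W` over `𝔸_E` is `(𝕋 ⊗ 1)` with `𝕋 = T_V ⊗ 1 ⊗ₖ T_W ⊗ 1 ∈ M(𝔸_F)`. [folklore] -/
private theorem adelicForm_kronecker_eq_map :
    adelicForm E N (TV.map (algebraMap F E)) ⊗ₖ adelicForm E 1 (TW.map (algebraMap F E)) =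
      (TV.map (algebraMap F (AdeleRing (𝓞 F) F)) ⊗ₖ TW.map (algebraMap F (AdeleRing (𝓞 F) F))).map
        (AdeleRing.baseChange F E) := by
  rw [adelicForm_eq_map_map E N TV rfl, adelicForm_eq_map_map E 1 TW rfl, kronecker_map']

include hd in
/-- **THE CLOSED FORMULA FOR THE HERMITIAN NORM**: with `x¹ = x ∘ Fin.castAdd n`, `x² = x ∘ Fin.natAdd n` and
`𝕋 = adelicGram` (the `𝔸_F`-points of the rational symmetric Gram matrix `gram = reindex e e (T_V ⊗ₖ T_W)`),
`hNorm x = x¹ ⬝ᵥ 𝕋 x¹ - (d ⊗ 1) · (x² ⬝ᵥ 𝕋⁻¹ x²)` — Weil's invariant `i_X` of the doubled carrier is an `F`-RATIONAL quadratic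
form in the Darboux coordinates (`re h(z, z) = aᵀ T a - d bᵀ T b` for `z = a + bδ`). [cite: Weil1965, Chap. IV n° 41, (35) p. 59] -/
theorem hNorm_eq_sub_dotProduct (x : Fin (n + n) → AdeleRing (𝓞 F) F) :
    hNorm F E c hcδ hδ N e TV hVd TW hWd x =
      (fun i => x (Fin.castAdd n i)) ⬝ᵥ UnitaryDualPair.adelicGram F e TV TW *ᵥ (fun i => x (Fin.castAdd n i)) -
        algebraMap F (AdeleRing (𝓞 F) F) d *
          ((fun i => x (Fin.natAdd n i)) ⬝ᵥ (UnitaryDualPair.adelicGram F e TV TW)⁻¹ *ᵥ fun i => x (Fin.natAdd n i)) := by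
  have h := (isQuadraticCoordinates_adele E c hcδ hδ hd).re_hermForm_darboux e
    (T := TV.map (algebraMap F (AdeleRing (𝓞 F) F)) ⊗ₖ TW.map (algebraMap F (AdeleRing (𝓞 F) F)))
    (G := UnitaryDualPair.adelicGram F e TV TW) rfl (UnitaryDualPair.isUnit_det_adelicGram F e hVd hWd)
    (adelicForm_kronecker_eq_map F E N TV TW) (σ := conjAdele F E c)
    (fun a => by rw [conjAdele_apply, AdeleRing.smul_baseChange])
    (by rw [← algebraMap_conj, RingHom.coe_coe, hcδ, map_neg]) (x ∘ ⇑finSumFinEquiv)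
  have h1 : (x ∘ ⇑finSumFinEquiv) ∘ Sum.inl = fun i => x (Fin.castAdd n i) := by
    funext i; simp only [Function.comp_apply, finSumFinEquiv_apply_left]
  have h2 : (x ∘ ⇑finSumFinEquiv) ∘ Sum.inr = fun i => x (Fin.natAdd n i) := by
    funext i; simp only [Function.comp_apply, finSumFinEquiv_apply_right]
  rwa [h1, h2] at h

/-- `𝕋 ⊗ 1` read at `v` is `gram ⊗ 1 ∈ M_n(F_v)`. [folklore] -/
private theorem adelicGram_map_adeleEval (v : HeightOneSpectrum (𝓞 F)) :
    (UnitaryDualPair.adelicGram F e TV TW).map (AdelicGroupData.adeleEval F v) =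
      (UnitaryDualPair.gram F e TV TW).map (algebraMap F (v.adicCompletion F)) := by
  rw [UnitaryDualPair.adelicGram_eq_map, Matrix.map_map]
  congr 1

/-- a ring map takes the inverse of an invertible matrix to the inverse. [folklore] -/
private theorem map_nonsing_inv_of_isUnit {R S : Type*} [CommRing R] [CommRing S] {m : Type*} [Fintype m] [DecidableEq m]
    (f : R →+* S) {G : Matrix m m R} (hG : IsUnit G.det) : (G⁻¹).map f = (G.map f)⁻¹ := by
  symm
  refine Matrix.inv_eq_right_inv ?_
  rw [← Matrix.map_mul, Matrix.mul_nonsing_inv G hG, Matrix.map_one f (map_zero f) (map_one f)]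

/-- `(x_v)¹ = (x¹)_v` (definitional bookkeeping for `AdelicVector.evalAt`). [folklore] -/
private theorem evalAt_comp_eq (v : HeightOneSpectrum (𝓞 F)) (x : Fin (n + n) → AdeleRing (𝓞 F) F) {m : ℕ}
    (f : Fin m → Fin (n + n)) :
    (fun i => AdelicVector.evalAt F (Fin (n + n)) v x (f i)) = ⇑(AdelicGroupData.adeleEval F v) ∘ fun i => x (f i) := by
  funext i
  rfl

include hd in
/-- **THE `v`-COMPONENT OF THE HERMITIAN NORM** (`v` a finite place of `F`): with `x_v = AdelicVector.evalAt x ∈ F_v^{n+n}` and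
`𝕋_v = gram ⊗ 1 ∈ M_n(F_v)`, `(hNorm x)_v = x_v¹ ⬝ᵥ 𝕋_v x_v¹ - d · (x_v² ⬝ᵥ 𝕋_v⁻¹ x_v²)` — the invariant is computed place by
place (the map `X□(𝔸) → X□(F_v)` of ★ `AdelicVectorPlaceSplitting`). [cite: Weil1965, Chap. IV n° 41, (35) p. 59] -/
theorem evalAt_hNorm (v : HeightOneSpectrum (𝓞 F)) (x : Fin (n + n) → AdeleRing (𝓞 F) F) :
    AdelicGroupData.adeleEval F v (hNorm F E c hcδ hδ N e TV hVd TW hWd x) =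
      (fun i => AdelicVector.evalAt F (Fin (n + n)) v x (Fin.castAdd n i)) ⬝ᵥ
          (UnitaryDualPair.gram F e TV TW).map (algebraMap F (v.adicCompletion F)) *ᵥ
            (fun i => AdelicVector.evalAt F (Fin (n + n)) v x (Fin.castAdd n i)) -
        algebraMap F (v.adicCompletion F) d *
          ((fun i => AdelicVector.evalAt F (Fin (n + n)) v x (Fin.natAdd n i)) ⬝ᵥ
            ((UnitaryDualPair.gram F e TV TW).map (algebraMap F (v.adicCompletion F)))⁻¹ *ᵥ
              fun i => AdelicVector.evalAt F (Fin (n + n)) v x (Fin.natAdd n i)) := by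
  have hmv : ∀ (M : Matrix (Fin n) (Fin n) (AdeleRing (𝓞 F) F)) (w : Fin n → AdeleRing (𝓞 F) F),
      ⇑(AdelicGroupData.adeleEval F v) ∘ (M *ᵥ w) =
        M.map (AdelicGroupData.adeleEval F v) *ᵥ (⇑(AdelicGroupData.adeleEval F v) ∘ w) := fun M w => by
    funext i
    exact RingHom.map_mulVec _ M w i
  have hdv : AdelicGroupData.adeleEval F v (algebraMap F (AdeleRing (𝓞 F) F) d) = algebraMap F (v.adicCompletion F) d := by
    rw [AdelicGroupData.adeleEval_apply]
    change algebraMap F (FiniteAdeleRing (𝓞 F) F) d v = _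
    rw [FiniteAdeleRing.algebraMap_apply]
    exact adicCompletion_coe_eq_algebraMap (𝓞 F) F v d
  rw [hNorm_eq_sub_dotProduct F E c hcδ hδ hd N e TV hVd TW hWd, map_sub, map_mul, RingHom.map_dotProduct,
    RingHom.map_dotProduct, hmv, hmv, map_nonsing_inv_of_isUnit _ (UnitaryDualPair.isUnit_det_adelicGram F e hVd hWd),
    adelicGram_map_adeleEval, evalAt_comp_eq, evalAt_comp_eq, hdv]

/-! ## §3 The split coordinates `β_v` at a place `v` with `s² = d` in `F_v` -/

section SplitPlace

variable (v : HeightOneSpectrum (𝓞 F))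

include hV hW in
/-- the Gram matrix `gram ⊗ 1 ∈ M_n(F_v)` of `Res(V ⊗ W) ⊗ F_v` is symmetric. [cite: GelbartRogawski1991, §3.1 p. 454] -/
theorem isSymm_gram_map : ((UnitaryDualPair.gram F e TV TW).map (algebraMap F (v.adicCompletion F))).IsSymm :=
  (show (Matrix.reindex e e (TV ⊗ₖ TW)).IsSymm from (isSymm_kronecker hV hW).submatrix _).map _

include hVd hWd in
/-- the Gram matrix `gram ⊗ 1 ∈ M_n(F_v)` of `Res(V ⊗ W) ⊗ F_v` is invertible. [cite: GelbartRogawski1991, §3.1 p. 454] -/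
theorem isUnit_det_gram_map :
    IsUnit ((UnitaryDualPair.gram F e TV TW).map (algebraMap F (v.adicCompletion F))).det := by
  rw [← RingHom.mapMatrix_apply, ← RingHom.map_det]
  exact (UnitaryDualPair.isUnit_det_gram F e hVd hWd).map _

include hδ hd in
omit [NumberField E] [Algebra.IsQuadraticExtension F E] in
/-- a square root `s` of `d` in `F_v` is non-zero (`d = δ² ≠ 0`). [folklore] -/
private theorem sqrt_ne_zero {s : v.adicCompletion F} (hs : s * s = algebraMap F (v.adicCompletion F) d) : s ≠ 0 := by
  intro h0
  rw [h0, mul_zero, eq_comm, map_eq_zero_iff _ (algebraMap F (v.adicCompletion F)).injective] at hs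
  apply hδ
  have : δ * δ = 0 := by rw [hd, hs, map_zero]
  exact mul_self_eq_zero.1 this

/-- `2 ≠ 0` in `F_v` (characteristic zero). [folklore] -/
private theorem two_ne_zero_adicCompletion : (2 : v.adicCompletion F) ≠ 0 := by
  rw [show (2 : v.adicCompletion F) = algebraMap F (v.adicCompletion F) 2 by rw [map_ofNat],
    map_ne_zero_iff _ (algebraMap F (v.adicCompletion F)).injective]
  exact two_ne_zero

include hV hW hVd hWd hδ hd in
omit [NumberField E] [Algebra.IsQuadraticExtension F E] in
/-- **THE SPLIT COORDINATES `β_v` AT A PLACE `v` OF `F` WITH `s ∈ F_v`, `s² = d` (i.e. `v` split in `E = F(δ)`).**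
With `𝕋_v = gram ⊗ 1 ∈ M_n(F_v)`, `y¹ = y ∘ Fin.castAdd n`, `y² = y ∘ Fin.natAdd n`, there is an `F_v`-linear equivalence
`β_v : F_v^{n+n} ≃ F_v^n × F_v^n` with
(1) `β_v y = (y¹ + s 𝕋_v⁻¹ y², 𝕋_v y¹ - s y²)`;
(2) `β_v⁻¹ (p, q) = (½ (p + 𝕋_v⁻¹ q), (2s)⁻¹ (𝕋_v p - q))` (read through `finSumFinEquiv`);
(3) `Q_v y := y¹ ⬝ᵥ 𝕋_v y¹ - d · (y² ⬝ᵥ 𝕋_v⁻¹ y²) = (β_v y).1 ⬝ᵥ (β_v y).2` — by `evalAt_hNorm`, `Q_v(x_v) = (hNorm x)_v`, so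
    the fibre `hNorm = b` at `v` is the fibre `x ⬝ᵥ y = b` of the split form (`a_v = 1`);
(4) `β_v` maps the product Haar measure of `F_v^{n+n}` to `c • (Haar × Haar)` with `c > 0`.
The action of `U(J_V ⊗ J_W)(F_v)` in these coordinates is the dual pair `(g_w ·, (g_w⁻¹)ᵀ ·)`:
★ `QuadraticHermitianNormSplitForm.exists_gl_split_intertwine` ∕ `exists_mem_unitaryGroupOfForm_of_gl` at the local datum
★ `isQuadraticCoordinates_local`. [cite: Weil1965, Chap. II n° 21–23, pp. 32–36; Chap. VI n° 52, pp. 77–78] -/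
theorem exists_splitBeta_adicCompletion [MeasurableSpace (v.adicCompletion F)] [BorelSpace (v.adicCompletion F)]
    (μ : Measure (v.adicCompletion F)) [μ.IsAddHaarMeasure]
    {s : v.adicCompletion F} (hs : s * s = algebraMap F (v.adicCompletion F) d) :
    ∃ β : (Fin (n + n) → v.adicCompletion F) ≃ₗ[v.adicCompletion F]
        ((Fin n → v.adicCompletion F) × (Fin n → v.adicCompletion F)),
      (∀ y, β y =
        ((fun i => y (Fin.castAdd n i)) +
            s • ((UnitaryDualPair.gram F e TV TW).map (algebraMap F (v.adicCompletion F)))⁻¹ *ᵥ (fun i => y (Fin.natAdd n i)),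
          (UnitaryDualPair.gram F e TV TW).map (algebraMap F (v.adicCompletion F)) *ᵥ (fun i => y (Fin.castAdd n i)) -
            s • (fun i => y (Fin.natAdd n i)))) ∧
      (∀ p q, β.symm (p, q) = fun j =>
        Sum.elim ((2 : v.adicCompletion F)⁻¹ •
            (p + ((UnitaryDualPair.gram F e TV TW).map (algebraMap F (v.adicCompletion F)))⁻¹ *ᵥ q))
          ((2 * s)⁻¹ • ((UnitaryDualPair.gram F e TV TW).map (algebraMap F (v.adicCompletion F)) *ᵥ p - q))
          (finSumFinEquiv.symm j)) ∧
      (∀ y, (fun i => y (Fin.castAdd n i)) ⬝ᵥ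
            (UnitaryDualPair.gram F e TV TW).map (algebraMap F (v.adicCompletion F)) *ᵥ (fun i => y (Fin.castAdd n i)) -
          algebraMap F (v.adicCompletion F) d *
            ((fun i => y (Fin.natAdd n i)) ⬝ᵥ
              ((UnitaryDualPair.gram F e TV TW).map (algebraMap F (v.adicCompletion F)))⁻¹ *ᵥ (fun i => y (Fin.natAdd n i))) =
        (β y).1 ⬝ᵥ (β y).2) ∧
      (∃ cst : ℝ≥0, 0 < cst ∧
        Measure.map β (Measure.pi fun _ : Fin (n + n) => μ) =
          (cst : ℝ≥0∞) • ((Measure.pi fun _ : Fin n => μ).prod (Measure.pi fun _ : Fin n => μ))) := by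
  obtain ⟨β₀, hβ₀, hβ₀s⟩ := exists_splitEquiv ((UnitaryDualPair.gram F e TV TW).map (algebraMap F (v.adicCompletion F)))
    (isUnit_det_gram_map F N e TV hVd TW hWd v) (sqrt_ne_zero F E hδ hd v hs) (two_ne_zero_adicCompletion F v)
  set β : (Fin (n + n) → v.adicCompletion F) ≃ₗ[v.adicCompletion F]
      ((Fin n → v.adicCompletion F) × (Fin n → v.adicCompletion F)) :=
    (LinearEquiv.funCongrLeft (v.adicCompletion F) (v.adicCompletion F) finSumFinEquiv).trans β₀ with hβdef
  have h1 : ∀ y : Fin (n + n) → v.adicCompletion F,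
      (LinearEquiv.funCongrLeft (v.adicCompletion F) (v.adicCompletion F) finSumFinEquiv y) ∘ Sum.inl =
        fun i => y (Fin.castAdd n i) := fun y => by
    funext i
    simp only [Function.comp_apply, LinearEquiv.funCongrLeft_apply, LinearMap.funLeft_apply, finSumFinEquiv_apply_left]
  have h2 : ∀ y : Fin (n + n) → v.adicCompletion F,
      (LinearEquiv.funCongrLeft (v.adicCompletion F) (v.adicCompletion F) finSumFinEquiv y) ∘ Sum.inr =
        fun i => y (Fin.natAdd n i) := fun y => by
    funext i
    simp only [Function.comp_apply, LinearEquiv.funCongrLeft_apply, LinearMap.funLeft_apply, finSumFinEquiv_apply_right]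
  have hβ : ∀ y, β y =
      ((fun i => y (Fin.castAdd n i)) +
          s • ((UnitaryDualPair.gram F e TV TW).map (algebraMap F (v.adicCompletion F)))⁻¹ *ᵥ (fun i => y (Fin.natAdd n i)),
        (UnitaryDualPair.gram F e TV TW).map (algebraMap F (v.adicCompletion F)) *ᵥ (fun i => y (Fin.castAdd n i)) -
          s • (fun i => y (Fin.natAdd n i))) := fun y => by
    rw [hβdef, LinearEquiv.trans_apply, hβ₀, h1, h2]
  refine ⟨β, hβ, fun p q => ?_, fun y => ?_, SplitPlace.exists_map_linearEquiv_pi_eq_smul_prod μ β⟩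
  · rw [hβdef, LinearEquiv.trans_symm, LinearEquiv.trans_apply, hβ₀s, LinearEquiv.funCongrLeft_symm]
    funext j
    simp only [LinearEquiv.funCongrLeft_apply, LinearMap.funLeft_apply]
  · rw [hβ, ← dotProduct_sub_eq_split (isSymm_gram_map F N e TV hV TW hW v) (isUnit_det_gram_map F N e TV hVd TW hWd v) s, hs]

end SplitPlace

/-! ## §4 The group side at `v`: `U(J_V ⊗ J_W)(F_v)` acts through the dual pair `(g_w, (g_w⁻¹)ᵀ)`, ONTO `GL_n(F_v)` -/

section GroupSide

variable (v : HeightOneSpectrum (𝓞 F))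

omit [Algebra.IsQuadraticExtension F E] in
/-- **the `v`-component of the adelic hermitian matrix of `V ⊗ W` is `(T_V ⊗ 1 ⊗ₖ T_W ⊗ 1) ⊗ 1 ∈ M(E ⊗ F_v)`** — the
`T.map φ` shape of ★ `QuadraticHermitianNormSplitForm` at the local quadratic datum ★ `isQuadraticCoordinates_local`
(so that the `v`-component `toLocal v h` of an adelic unitary `h` of `J_V ⊗ J_W` satisfies the hypothesis `hg` below,
★ `localForm_eq_map`). [cite: GelbartRogawski1991, §3.1 p. 454] -/
theorem adelicPairForm_map_adeleToLocal :
    (adelicForm E N (TV.map (algebraMap F E)) ⊗ₖ adelicForm E 1 (TW.map (algebraMap F E))).map (adeleToLocal E v) =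
      (TV.map (algebraMap F (v.adicCompletion F)) ⊗ₖ TW.map (algebraMap F (v.adicCompletion F))).map (toLocalRing E v) := by
  rw [kronecker_map', localForm_eq_map E N v TV rfl, localForm_eq_map E 1 v TW rfl, ← kronecker_map']

/-- `reindex e e (T_V ⊗ 1 ⊗ₖ T_W ⊗ 1) = gram ⊗ 1` over `F_v`. [folklore] -/
private theorem reindex_kronecker_map_eq_gram_map :
    Matrix.reindex e e (TV.map (algebraMap F (v.adicCompletion F)) ⊗ₖ TW.map (algebraMap F (v.adicCompletion F))) =
      (UnitaryDualPair.gram F e TV TW).map (algebraMap F (v.adicCompletion F)) := by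
  rw [kronecker_map_map]
  rfl

/-- `s² = d` read against the coercion `(d : F_v)` of the local quadratic datum. [folklore] -/
private theorem sq_eq_coe {s : v.adicCompletion F} (hs : s * s = algebraMap F (v.adicCompletion F) d) :
    s * s = (d : v.adicCompletion F) := by
  rw [hs, adicCompletion_coe_eq_algebraMap]

include hV hW hVd hWd hd in
/-- **THE ACTION OF `U(J_V ⊗ J_W)(F_v)` IN THE SPLIT COORDINATES IS THE DUAL PAIR `(g_w, (g_w⁻¹)ᵀ)`** (★
`QuadraticHermitianNormSplitForm.exists_gl_split_intertwine` at the local quadratic datum ★ `isQuadraticCoordinates_local`,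
renumbered by `finSumFinEquiv`): for `g = g₁ + g₂δ ∈ U(σ_v, (T_V ⊗ 1 ⊗ₖ T_W ⊗ 1) ⊗ 1)` (`g₁ = re_v ∘ g`, `g₂ = im_v ∘ g` in the
coordinates `E ⊗ F_v = F_v ⊕ F_v δ` of ★ `quadraticLocalEquiv`) and `s² = d`, `g_w := reindex e e (g₁ + s g₂) ∈ GL_n(F_v)` and,
with `A y := θ (g (θ⁻¹ y))` the geometric action (`θ` = ★ `darboux` of `𝕋_v = gram ⊗ 1`, `g` through ★ `resAut`, ★ `reindexW e`
— the local shape of ★ `vDiagAct`∕`toHermVec_vDiagAct`), the split coordinates of §3 intertwine `A` with `(g_w ·, (g_w⁻¹)ᵀ ·)`.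
[cite: Weil1965, Chap. II n° 21–23, pp. 32–36; Chap. VI n° 52, pp. 77–78] -/
theorem exists_gl_split_intertwine_adicCompletion {s : v.adicCompletion F}
    (hs : s * s = algebraMap F (v.adicCompletion F) d) {g : GL (Fin N × Fin 1) (LocalRing E v)}
    (hg : g ∈ unitaryGroupOfForm (conjLocal E c v)
      ((TV.map (algebraMap F (v.adicCompletion F)) ⊗ₖ TW.map (algebraMap F (v.adicCompletion F))).map (toLocalRing E v))) :
    ∃ gW : GL (Fin n) (v.adicCompletion F),
      (gW : Matrix (Fin n) (Fin n) (v.adicCompletion F)) =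
        Matrix.reindex e e ((g : Matrix _ _ (LocalRing E v)).map (re (quadraticLocalEquiv E v c hcδ hδ).toLinearEquiv.toAddEquiv) +
          s • (g : Matrix _ _ (LocalRing E v)).map (im (quadraticLocalEquiv E v c hcδ hδ).toLinearEquiv.toAddEquiv)) ∧
      ((gW⁻¹ : GL (Fin n) (v.adicCompletion F)) : Matrix (Fin n) (Fin n) (v.adicCompletion F)) =
        ((UnitaryDualPair.gram F e TV TW).map (algebraMap F (v.adicCompletion F)))⁻¹ *
          (Matrix.reindex e e ((g : Matrix _ _ (LocalRing E v)).map (re (quadraticLocalEquiv E v c hcδ hδ).toLinearEquiv.toAddEquiv) -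
            s • (g : Matrix _ _ (LocalRing E v)).map (im (quadraticLocalEquiv E v c hcδ hδ).toLinearEquiv.toAddEquiv)))ᵀ *
          (UnitaryDualPair.gram F e TV TW).map (algebraMap F (v.adicCompletion F)) ∧
      ∀ y : Fin (n + n) → v.adicCompletion F,
        SymplecticMatrix.darboux _ (isUnit_det_gram_map F N e TV hVd TW hWd v) (reindexW (v.adicCompletion F) e
              ((isQuadraticCoordinates_local E v c hcδ hδ hd).resAut (Fin N × Fin 1) g
                ((reindexW (v.adicCompletion F) e).symm
                  ((SymplecticMatrix.darboux _ (isUnit_det_gram_map F N e TV hVd TW hWd v)).symm (y ∘ ⇑finSumFinEquiv))))) ∘ Sum.inl +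
            s • ((UnitaryDualPair.gram F e TV TW).map (algebraMap F (v.adicCompletion F)))⁻¹ *ᵥ
              (SymplecticMatrix.darboux _ (isUnit_det_gram_map F N e TV hVd TW hWd v) (reindexW (v.adicCompletion F) e
                ((isQuadraticCoordinates_local E v c hcδ hδ hd).resAut (Fin N × Fin 1) g
                  ((reindexW (v.adicCompletion F) e).symm
                    ((SymplecticMatrix.darboux _ (isUnit_det_gram_map F N e TV hVd TW hWd v)).symm (y ∘ ⇑finSumFinEquiv))))) ∘
                Sum.inr) =
          (gW : Matrix (Fin n) (Fin n) (v.adicCompletion F)) *ᵥ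
            ((fun i => y (Fin.castAdd n i)) +
              s • ((UnitaryDualPair.gram F e TV TW).map (algebraMap F (v.adicCompletion F)))⁻¹ *ᵥ fun i => y (Fin.natAdd n i)) ∧
        (UnitaryDualPair.gram F e TV TW).map (algebraMap F (v.adicCompletion F)) *ᵥ
              (SymplecticMatrix.darboux _ (isUnit_det_gram_map F N e TV hVd TW hWd v) (reindexW (v.adicCompletion F) e
                ((isQuadraticCoordinates_local E v c hcδ hδ hd).resAut (Fin N × Fin 1) g
                  ((reindexW (v.adicCompletion F) e).symm
                    ((SymplecticMatrix.darboux _ (isUnit_det_gram_map F N e TV hVd TW hWd v)).symm (y ∘ ⇑finSumFinEquiv))))) ∘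
                Sum.inl) -
            s • (SymplecticMatrix.darboux _ (isUnit_det_gram_map F N e TV hVd TW hWd v) (reindexW (v.adicCompletion F) e
                ((isQuadraticCoordinates_local E v c hcδ hδ hd).resAut (Fin N × Fin 1) g
                  ((reindexW (v.adicCompletion F) e).symm
                    ((SymplecticMatrix.darboux _ (isUnit_det_gram_map F N e TV hVd TW hWd v)).symm (y ∘ ⇑finSumFinEquiv))))) ∘
                Sum.inr) =
          ((gW⁻¹ : GL (Fin n) (v.adicCompletion F)) : Matrix (Fin n) (Fin n) (v.adicCompletion F))ᵀ *ᵥ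
            ((UnitaryDualPair.gram F e TV TW).map (algebraMap F (v.adicCompletion F)) *ᵥ (fun i => y (Fin.castAdd n i)) -
              s • fun i => y (Fin.natAdd n i)) := by
  have hT : (TV.map (algebraMap F (v.adicCompletion F)) ⊗ₖ TW.map (algebraMap F (v.adicCompletion F))).IsSymm := by
    rw [kronecker_map_map]; exact (isSymm_kronecker hV hW).map _
  obtain ⟨gW, h1, h2, h3⟩ := (isQuadraticCoordinates_local E v c hcδ hδ hd).exists_gl_split_intertwine e hT
    (reindex_kronecker_map_eq_gram_map F N e TV TW v) (isUnit_det_gram_map F N e TV hVd TW hWd v) rfl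
    (σ := conjLocal E c v) (conjLocal_toLocalRing c v) (by rw [conjLocal_algebraMap, hcδ, map_neg])
    (sq_eq_coe F v hs) hg
  refine ⟨gW, h1, h2, fun y => ?_⟩
  have hy1 : (y ∘ ⇑finSumFinEquiv) ∘ Sum.inl = fun i => y (Fin.castAdd n i) := by
    funext i; simp only [Function.comp_apply, finSumFinEquiv_apply_left]
  have hy2 : (y ∘ ⇑finSumFinEquiv) ∘ Sum.inr = fun i => y (Fin.natAdd n i) := by
    funext i; simp only [Function.comp_apply, finSumFinEquiv_apply_right]
  have h3y := h3 (y ∘ ⇑finSumFinEquiv)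
  rw [hy1, hy2] at h3y
  exact h3y

include hV hW hVd hWd hδ hd in
/-- **`U(J_V ⊗ J_W)(F_v) → GL_n(F_v)`, `g ↦ g_w`, IS ONTO at a split place** (★
`QuadraticHermitianNormSplitForm.exists_mem_unitaryGroupOfForm_of_gl` at the local quadratic datum): every
`P ∈ GL_n(F_v)` is the `w`-component `reindex e e (g₁ + s g₂)` of some local unitary `g` — Weil's `U(i)_v ≅ GL(m, 𝔎_v)` for an
algebra of type (II). [cite: Weil1965, Chap. II n° 21–23, pp. 32–36; Chap. VI n° 52, pp. 77–78] -/
theorem exists_mem_unitaryGroupOfForm_adicCompletion_of_gl {s : v.adicCompletion F}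
    (hs : s * s = algebraMap F (v.adicCompletion F) d) (P : GL (Fin n) (v.adicCompletion F)) :
    ∃ g : GL (Fin N × Fin 1) (LocalRing E v),
      g ∈ unitaryGroupOfForm (conjLocal E c v)
        ((TV.map (algebraMap F (v.adicCompletion F)) ⊗ₖ TW.map (algebraMap F (v.adicCompletion F))).map (toLocalRing E v)) ∧
      Matrix.reindex e e ((g : Matrix _ _ (LocalRing E v)).map (re (quadraticLocalEquiv E v c hcδ hδ).toLinearEquiv.toAddEquiv) +
          s • (g : Matrix _ _ (LocalRing E v)).map (im (quadraticLocalEquiv E v c hcδ hδ).toLinearEquiv.toAddEquiv)) =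
        (P : Matrix (Fin n) (Fin n) (v.adicCompletion F)) := by
  have hT : (TV.map (algebraMap F (v.adicCompletion F)) ⊗ₖ TW.map (algebraMap F (v.adicCompletion F))).IsSymm := by
    rw [kronecker_map_map]; exact (isSymm_kronecker hV hW).map _
  exact (isQuadraticCoordinates_local E v c hcδ hδ hd).exists_mem_unitaryGroupOfForm_of_gl e hT
    (reindex_kronecker_map_eq_gram_map F N e TV TW v) (isUnit_det_gram_map F N e TV hVd TW hWd v) rfl
    (σ := conjLocal E c v) (conjLocal_toLocalRing c v) (by rw [conjLocal_algebraMap, hcδ, map_neg])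
    (sq_eq_coe F v hs) (sqrt_ne_zero F E hδ hd v hs) (two_ne_zero_adicCompletion F v) P

end GroupSide

/-! ## §5 The `«local»` (`U(J_V)(F_v)`) currency of the group side -/

section LocalCoordinates

variable (v : HeightOneSpectrum (𝓞 F))

omit [Algebra.IsQuadraticExtension F E] in
/-- **`u ⊗ 1` is unitary for the pair form**: for `u ∈ U(J_V)(F_v) = «local» E c N J_V v` the element `u ⊗ 1 ∈ GL_{N×1}(E ⊗ F_v)`
(the shape of ★ `adelicInl h = h ⊗ 1` read at `v`) lies in the unitary group of `(T_V ⊗ 1 ⊗ₖ T_W ⊗ 1) ⊗ 1` — the hypothesis `hg` of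
`exists_gl_split_intertwine_adicCompletion`. [cite: MoeglinVignerasWaldspurger1987, Ch. 1 I.17] -/
theorem kroneckerGL_one_mem_pairForm {u : GL (Fin N) (LocalRing E v)}
    (hu : u ∈ UnitaryGroup.«local» E c N (TV.map (algebraMap F E)) v) :
    kroneckerGL (u, (1 : GL (Fin 1) (LocalRing E v))) ∈ unitaryGroupOfForm (conjLocal E c v)
      ((TV.map (algebraMap F (v.adicCompletion F)) ⊗ₖ TW.map (algebraMap F (v.adicCompletion F))).map (toLocalRing E v)) := by
  have hu' : u ∈ unitaryGroupOfForm (conjLocal E c v) ((adelicForm E N (TV.map (algebraMap F E))).map (adeleToLocal E v)) := hu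
  rw [localForm_eq_map E N v TV rfl] at hu'
  have h1 : (1 : GL (Fin 1) (LocalRing E v)) ∈ unitaryGroupOfForm (conjLocal E c v)
      ((TW.map (algebraMap F (v.adicCompletion F))).map (toLocalRing E v)) := Subgroup.one_mem _
  have h := kroneckerGL_mem_unitaryGroupOfForm (conjLocal E c v) hu' h1
  rwa [← kronecker_map'] at h

include hVd in
/-- `det (T_V ⊗ 1)` reindexed to `Fin n` is a unit in `F_v`. [folklore] -/
private theorem isUnit_det_reindex_TV_map (e' : Fin N ≃ Fin n) :
    IsUnit (Matrix.reindex e' e' (TV.map (algebraMap F (v.adicCompletion F)))).det := by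
  rw [Matrix.det_reindex_self, ← RingHom.mapMatrix_apply, ← RingHom.map_det]
  exact hVd.map _

omit [Algebra.IsQuadraticExtension F E] in
/-- the `w`-component of `u ⊗ 1`, renumbered by `e`, is the `w`-component of `u` renumbered by `e' := (i ↦ e (i, 0))`. [folklore] -/
private theorem reindex_kroneckerGL_one_map (u : GL (Fin N) (LocalRing E v)) (f g : LocalRing E v →+ v.adicCompletion F)
    (s : v.adicCompletion F) :
    Matrix.reindex e e
        ((kroneckerGL (u, (1 : GL (Fin 1) (LocalRing E v)))).val.map f +
          s • (kroneckerGL (u, (1 : GL (Fin 1) (LocalRing E v)))).val.map g) =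
      Matrix.reindex ((Equiv.prodUnique (Fin N) (Fin 1)).symm.trans e) ((Equiv.prodUnique (Fin N) (Fin 1)).symm.trans e)
        (u.val.map f + s • u.val.map g) := by
  refine Matrix.ext fun k l => ?_
  simp only [Matrix.reindex_apply, Matrix.submatrix_apply, Matrix.add_apply, Matrix.smul_apply, Matrix.map_apply,
    coe_kroneckerGL, Matrix.kroneckerMap_apply, Units.val_one, Equiv.symm_trans_apply, Equiv.symm_symm,
    Equiv.prodUnique_apply]
  rw [Subsingleton.elim ((e.symm k).2) ((e.symm l).2), Matrix.one_apply_eq, mul_one]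

include hV hVd hδ hd in
/-- **`U(J_V)(F_v) → GL_n(F_v)`, `u ↦ (u ⊗ 1)_w`, IS ONTO at a split place, in the `«local»` currency** (★
`QuadraticHermitianNormSplitForm.exists_mem_unitaryGroupOfForm_of_gl` at the local quadratic datum for `J_V` alone, then
`u ⊗ 1`): every `P ∈ GL_n(F_v)` is `reindex e e ((u ⊗ 1)₁ + s (u ⊗ 1)₂)` for some `u ∈ «local» E c N J_V v` — the local group
that ★ `UnitaryGroupPlaceInclusion` lifts into `U(J_V)(𝔸)`. [cite: Weil1965, Chap. II n° 21–23, pp. 32–36; Chap. VI n° 52, pp. 77–78] -/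
theorem exists_mem_local_of_gl {s : v.adicCompletion F} (hs : s * s = algebraMap F (v.adicCompletion F) d)
    (P : GL (Fin n) (v.adicCompletion F)) :
    ∃ u : GL (Fin N) (LocalRing E v), u ∈ UnitaryGroup.«local» E c N (TV.map (algebraMap F E)) v ∧
      Matrix.reindex e e
          ((kroneckerGL (u, (1 : GL (Fin 1) (LocalRing E v)))).val.map (re (quadraticLocalEquiv E v c hcδ hδ).toLinearEquiv.toAddEquiv) +
            s • (kroneckerGL (u, (1 : GL (Fin 1) (LocalRing E v)))).val.map
              (im (quadraticLocalEquiv E v c hcδ hδ).toLinearEquiv.toAddEquiv)) =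
        (P : Matrix (Fin n) (Fin n) (v.adicCompletion F)) := by
  obtain ⟨u, hu, hP⟩ := (isQuadraticCoordinates_local E v c hcδ hδ hd).exists_mem_unitaryGroupOfForm_of_gl
    ((Equiv.prodUnique (Fin N) (Fin 1)).symm.trans e) (hV.map (algebraMap F (v.adicCompletion F)))
    (G := Matrix.reindex ((Equiv.prodUnique (Fin N) (Fin 1)).symm.trans e) ((Equiv.prodUnique (Fin N) (Fin 1)).symm.trans e)
      (TV.map (algebraMap F (v.adicCompletion F)))) rfl
    (isUnit_det_reindex_TV_map F N TV hVd v _) rfl (σ := conjLocal E c v) (conjLocal_toLocalRing c v)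
    (by rw [conjLocal_algebraMap, hcδ, map_neg]) (sq_eq_coe F v hs) (sqrt_ne_zero F E hδ hd v hs)
    (two_ne_zero_adicCompletion F v) P
  refine ⟨u, ?_, ?_⟩
  · show u ∈ unitaryGroupOfForm (conjLocal E c v) ((adelicForm E N (TV.map (algebraMap F E))).map (adeleToLocal E v))
    rw [localForm_eq_map E N v TV rfl]
    exact hu
  · rw [← hP]
    exact reindex_kroneckerGL_one_map F E N e v u _ _ s

end LocalCoordinates

end Literature.NumberTheory.Weil1965.UnitaryDoubling
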